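import Mathlib
import HarnessLib
import Summits.Ventures.LatticeQCDFlow.Scaling.IdentityFlowAcceptanceDiagonalLimit
import Summits.Ventures.LatticeQCDFlow.Scaling.TriangularRowCLT

/-!
# LatticeQCDFlow / Scaling — LOG-NORMAL UNIVERSALITY of the acceptance of factorised flow samplers:
# per-block log-weights `c·h_V/√V` with `Var h_V → σ²` give `acc_V → ∫∫ min(e^x, e^y) dN(−s/2, s)²`,
# `s = c²σ²`

HONEST FRAMING: exact (Metropolis-corrected) sampling algorithms for lattice gauge theory;
figures of merit are autocorrelation/cost numbers at stated couplings and volumes; no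
continuum-physics claim.

Venture `LatticeQCDFlow` (cell pub-lqcd), topic `Scaling`; FANOUT row 3 (`s0-u1-a`, S0-B
implementation A, GEN-19).  NEW WORK of the cell (row 3's triangular row CLT `Scaling/TriangularRowCLT`
+ the plumbing of `Scaling/IdentityFlowAcceptanceDiagonalLimit` + Hoeffding); NO definition is
introduced; nothing is cited.

## The statement

A FACTORISED flow sampler at volume `V` proposes `V` i.i.d. blocks from a law `ρ_V` and is
Metropolis-corrected against the product target with per-block log-weight `ℓ_V = (c/√V)·h_V`
(normalisation immaterial — the acceptance functional divides by `∫ e^{Σℓ} dρ_V^{⊗V}`).  If the block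
statistics are uniformly bounded (`|h_V| ≤ K`), centred (`∫ h_V dρ_V = 0`) and `Var_{ρ_V}(h_V) → σ²`,
then **`triangularPi_meanAccept_tendsto`**: the equilibrium acceptance converges to the LOG-NORMAL
acceptance law `∫∫ min(e^x, e^y) dN(−s/2, s)²`, `s = c²σ²` (`= erfc(|c|σ/2)`,
`triangularPi_meanAccept_tendsto_erfc`, via `Scoring/IMHLogNormalAcceptance`).  Row 3's diagonal
limit for the UNTRAINED sampler (`Scaling/IdentityFlowAcceptanceDiagonalLimit`: `ρ_V = ν`, `h_V = g`)
is the constant array; a TRAINED factorised flow whose residual per-block log-weight has standard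
deviation `≍ V^{−1/2}` is the general case — WHATEVER the block laws, only `s = lim V·Var(ℓ_V)`
survives: the scorers' log-normal inversion `σ(ā)` is asymptotically exact for every such sampler,
and an `O(1)` acceptance at volume `V` requires per-block log-weight fluctuations `O(V^{−1/2})`.
Along the same arrays the ESS fraction → `e^{−s}` (`triangularPi_essFrac_tendsto`) and the
Bhattacharyya ceiling → `e^{−s/4}` (`triangularPi_bhattacharyyaCeiling_tendsto`): all three figures
of merit are those of the log-normal weight model.

NOT CLAIMED: unbounded blocks (a Lindeberg condition would do); non-identical or dependent blocks
within a row (autoregressive / coupling-layer flows are not factorised); rates; any value at the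
cell's `(β, L)`; nothing re-scored.
-/

noncomputable section

namespace Summit.Ventures.LatticeQCDFlow.Theory2

open MeasureTheory ProbabilityTheory Filter Finset Real Set
open scoped Topology NNReal
open Literature.Probability.Distributions.PseudoMarginalNoise

variable {Y : Type*} {mY : MeasurableSpace Y} {ρ : ℕ → Measure Y} [∀ n, IsProbabilityMeasure (ρ n)]
  {h : ℕ → Y → ℝ}

/-- **LOG-NORMAL UNIVERSALITY.**  Block laws `ρ_n`, bounded centred block statistics `h_n`
(`|h_n| ≤ K`) with `Var_{ρ_n}(h_n) → σ²`, coupling constant `c`: the equilibrium acceptance of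
`ρ_n^{⊗n}`-proposals against the tilt by `(c/√n)Σᵢ h_n(yᵢ)` converges to
`∫∫ min(e^x, e^y) dN(−s/2, s)²`, `s = c²σ²`. [ours] -/
theorem triangularPi_meanAccept_tendsto (hm : ∀ n, Measurable (h n)) {K : ℝ}
    (hK : ∀ n y, |h n y| ≤ K) (h0 : ∀ n, ∫ y, h n y ∂ρ n = 0) {σ2 : ℝ}
    (hσ : Tendsto (fun n => Var[h n; ρ n]) atTop (𝓝 σ2)) (c : ℝ) :
    Tendsto (fun n : ℕ =>
        (∫ x, ∫ y, min (Real.exp (c / Real.sqrt n * ∑ i, h n (x i)))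
              (Real.exp (c / Real.sqrt n * ∑ i, h n (y i)))
            ∂(Measure.pi fun _ : Fin n => ρ n) ∂(Measure.pi fun _ : Fin n => ρ n))
          / ∫ x, Real.exp (c / Real.sqrt n * ∑ i, h n (x i)) ∂(Measure.pi fun _ : Fin n => ρ n))
      atTop (𝓝 (∫ x, ∫ y, min (Real.exp x) (Real.exp y)
        ∂(noiseLaw (c ^ 2 * σ2).toNNReal) ∂(noiseLaw (c ^ 2 * σ2).toNNReal))) := by
  -- basic facts on the array
  set v : ℝ := σ2 with hv
  have hv0 : 0 ≤ v := variance_limit_nonneg hσ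
  have hga : ∀ n, AEMeasurable (h n) (ρ n) := fun n => (hm n).aemeasurable
  have hgb : ∀ n, ∀ᵐ y ∂ρ n, h n y ∈ Set.Icc (-K) K := fun n => ae_of_all _ fun y => abs_le.1 (hK n y)
  have hvK : v ≤ K ^ 2 := by
    refine le_of_tendsto' hσ fun n => ?_
    exact (variance_le_sq_of_bounded (hgb n) (hga n)).trans (le_of_eq (by ring))
  -- the rows
  set P : (n : ℕ) → Measure (Fin n → Y) := fun n => Measure.pi fun _ : Fin n => ρ n with hP
  set S : (n : ℕ) → (Fin n → Y) → ℝ := fun n y => (Real.sqrt n)⁻¹ * ∑ i, h n (y i) with hS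
  have hSm : ∀ n, Measurable (S n) := fun n =>
    (Finset.measurable_sum _ fun i _ => (hm n).comp (measurable_pi_apply i)).const_mul _
  -- the laws `μₙ` of `Sₙ` and the Gaussian limit law
  haveI hPn : ∀ n, IsProbabilityMeasure ((P n).map (S n)) := fun n =>
    Measure.isProbabilityMeasure_map (hSm n).aemeasurable
  set μs : ℕ → ProbabilityMeasure ℝ := fun n => ⟨(P n).map (S n), hPn n⟩ with hμs
  set μ : ProbabilityMeasure ℝ := ⟨gaussianReal 0 v.toNNReal, inferInstance⟩ with hμ
  -- (1) the central limit theorem for the rows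
  have hclt : Tendsto μs atTop (𝓝 μ) := by
    have hZ : HasLaw (id : ℝ → ℝ) (gaussianReal 0 v.toNNReal) (gaussianReal 0 v.toNNReal) :=
      ⟨aemeasurable_id, Measure.map_id⟩
    have h := (triangularPi_tendstoInDistribution (P' := gaussianReal 0 v.toNNReal)
      hm hK h0 hσ hZ).tendsto
    simp only [Measure.map_id] at h
    convert h using 1
  -- exponential integrability of the laws
  have hexp : ∀ n (t : ℝ), Integrable (fun u => Real.exp (t * u)) ((μs n : Measure ℝ)) := by
    intro n t
    have hae : ∀ᵐ u ∂((P n).map (S n)), u ∈ Set.Icc (-(Real.sqrt n * K)) (Real.sqrt n * K) :=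
      (ae_map_iff (hSm n).aemeasurable
        (p := fun u => u ∈ Set.Icc (-(Real.sqrt n * K)) (Real.sqrt n * K)) measurableSet_Icc).2
        (ae_of_all _ fun y => pi_inv_sqrt_mul_sum_mem_Icc (hK n) n y)
    exact integrable_exp_mul_of_mem_Icc (X := id) aemeasurable_id hae
  have hexpP : ∀ n (t : ℝ), Integrable (fun u => Real.exp (t * u)) ((P n).map (S n)) :=
    fun n t => hexp n t
  have hexpG : ∀ t : ℝ, Integrable (fun u => Real.exp (t * u)) (μ : Measure ℝ) := fun t => by
    change Integrable (fun u => Real.exp (t * id u)) (gaussianReal 0 v.toNNReal)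
    exact (integrable_exp_mul_gaussianReal (μ := 0) (v := v.toNNReal) t)
  -- (2) the numerator
  set C : ℝ := Real.exp ((‖K - -K‖₊ / 2) ^ 2 * (2 * c) ^ 2 / 2) with hC
  have hnum : Tendsto (fun n => ∫ z, min (Real.exp (c * z.1)) (Real.exp (c * z.2))
        ∂(((μs n : Measure ℝ)).prod (μs n))) atTop
      (𝓝 (∫ z, min (Real.exp (c * z.1)) (Real.exp (c * z.2)) ∂((μ : Measure ℝ).prod μ))) := by
    refine tendsto_integral_prod_of_tendsto hclt (by fun_prop)
      (fun z => (lt_min (Real.exp_pos _) (Real.exp_pos _)).le) (C := C) ?_ ?_ ?_ ?_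
    · intro n
      exact (min_exp_prod_facts (μs n : Measure ℝ) c (hexp n c)
        (hexp n (2 * c))).2.1
    · intro n
      refine (min_exp_prod_facts (μs n : Measure ℝ) c (hexp n c)
        (hexp n (2 * c))).2.2.trans ?_
      change ∫ u, Real.exp (2 * c * u) ∂((P n).map (S n)) ≤ C
      rw [pi_integral_exp_mul_map_inv_sqrt_mul_sum (hm n) n (2 * c)]
      exact mgf_div_sqrt_pow_le (hga n) (hgb n) (h0 n) (2 * c) n
    · exact (min_exp_prod_facts (μ : Measure ℝ) c (hexpG c)
        (hexpG (2 * c))).2.1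
    · refine (min_exp_prod_facts (μ : Measure ℝ) c (hexpG c)
        (hexpG (2 * c))).2.2.trans ?_
      change ∫ u, Real.exp (2 * c * u) ∂(gaussianReal 0 v.toNNReal) ≤ C
      have hm := mgf_gaussianReal (p := gaussianReal 0 v.toNNReal) (X := id) (μ := 0) (v := v.toNNReal)
        Measure.map_id (2 * c)
      simp only [mgf, id_eq] at hm
      rw [show (fun u : ℝ => Real.exp (2 * c * u)) = fun u => Real.exp ((2 * c) * u) from rfl, hm,
        Real.coe_toNNReal v hv0, hC]
      apply Real.exp_le_exp.2
      have h1 : (‖K - -K‖₊ : ℝ) / 2 = |K| := by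
        rw [coe_nnnorm, Real.norm_eq_abs, sub_neg_eq_add, ← two_mul, abs_mul, abs_two]; ring
      rw [h1, sq_abs, zero_mul, zero_add]
      nlinarith [sq_nonneg c]
  -- (3) the denominator
  have hden : Tendsto (fun n : ℕ => ∫ x, Real.exp (c / Real.sqrt n * ∑ i, h n (x i)) ∂(P n)) atTop
      (𝓝 (Real.exp (c ^ 2 * v / 2))) := by
    -- the array `c·h_n`: bounded by `|c|K`, centred, variance `→ c²σ²`
    have hm' : ∀ n, Measurable (fun y => c * h n y) := fun n => (hm n).const_mul c
    have hK' : ∀ n y, |c * h n y| ≤ |c| * K := fun n y => by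
      rw [abs_mul]; exact mul_le_mul_of_nonneg_left (hK n y) (abs_nonneg c)
    have h0' : ∀ n, ∫ y, c * h n y ∂ρ n = 0 := fun n => by rw [integral_const_mul, h0 n, mul_zero]
    have hσ' : Tendsto (fun n => Var[fun y => c * h n y; ρ n]) atTop (𝓝 (c ^ 2 * v)) := by
      have e : ∀ n, Var[fun y => c * h n y; ρ n] = c ^ 2 * Var[h n; ρ n] := fun n =>
        variance_const_mul c (h n) (ρ n)
      simp_rw [e]
      exact hσ.const_mul (c ^ 2)
    have h := triangular_mgf_inv_sqrt_pow_tendsto hm' hK' h0' hσ'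
    refine h.congr fun n => ?_
    rw [pi_integral_exp_mul_sum (hm n) n, mgf_const_mul, ← div_eq_mul_inv]
  -- (4) assemble
  have hnum' : Tendsto (fun n : ℕ => ∫ x, ∫ y, min (Real.exp (c / Real.sqrt n * ∑ i, h n (x i)))
        (Real.exp (c / Real.sqrt n * ∑ i, h n (y i))) ∂(P n) ∂(P n)) atTop
      (𝓝 (∫ z, min (Real.exp (c * z.1)) (Real.exp (c * z.2)) ∂((μ : Measure ℝ).prod μ))) := by
    refine hnum.congr fun n => ?_
    have e : ∀ x : Fin n → Y, c / Real.sqrt n * ∑ i, h n (x i) = c * S n x := fun x => by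
      simp only [hS]; ring
    simp_rw [e]
    exact (integral_integral_min_exp_eq_integral_prod_map (P n) (hSm n) c (hexpP n c)
      (hexpP n (2 * c))).symm
  have hlim := hnum'.div hden (Real.exp_pos _).ne'
  -- (5) identify the limit with the log-normal acceptance law
  have hprodA : ∫ z, min (Real.exp (c * z.1)) (Real.exp (c * z.2)) ∂((μ : Measure ℝ).prod μ)
      = ∫ x, ∫ y, min (Real.exp (c * x)) (Real.exp (c * y)) ∂(gaussianReal 0 v.toNNReal)
          ∂(gaussianReal 0 v.toNNReal) :=
    integral_prod _ (min_exp_prod_facts (μ : Measure ℝ) c (hexpG c) (hexpG (2 * c))).1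
  rw [hprodA] at hlim
  set s : ℝ≥0 := (c ^ 2 * v).toNNReal with hs
  have hcv : 0 ≤ c ^ 2 * v := by positivity
  have hsR : (s : ℝ) = c ^ 2 * v := Real.coe_toNNReal _ hcv
  -- the log-normal law as an affine image of `N(0, v)`
  have hφ : noiseLaw s
      = (gaussianReal 0 v.toNNReal).map (fun u => c * u + (-(c ^ 2 * v / 2))) := by
    rw [show (fun u : ℝ => c * u + (-(c ^ 2 * v / 2))) = (fun u => u + (-(c ^ 2 * v / 2))) ∘ (fun u => c * u)
        from rfl,
      ← Measure.map_map (measurable_add_const _) (measurable_const_mul c), gaussianReal_map_const_mul,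
      gaussianReal_map_add_const, noiseLaw, hsR]
    congr 1
    · ring
    · ext
      push_cast
      rw [Real.coe_toNNReal _ hcv, Real.coe_toNNReal _ hv0]
  have hF2c : Continuous fun z : ℝ × ℝ => min (Real.exp z.1) (Real.exp z.2) := by fun_prop
  have hEq : (∫ x, ∫ y, min (Real.exp (c * x)) (Real.exp (c * y)) ∂(gaussianReal 0 v.toNNReal)
        ∂(gaussianReal 0 v.toNNReal)) / Real.exp (c ^ 2 * v / 2)
      = ∫ x, ∫ y, min (Real.exp x) (Real.exp y) ∂(noiseLaw s) ∂(noiseLaw s) := by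
    rw [hφ, integral_map (by fun_prop)
      (hF2c.stronglyMeasurable.integral_prod_right').aestronglyMeasurable]
    have inner : ∀ x : ℝ, ∫ y, min (Real.exp x) (Real.exp y)
          ∂((gaussianReal 0 v.toNNReal).map (fun u => c * u + (-(c ^ 2 * v / 2))))
        = ∫ u, min (Real.exp x) (Real.exp (c * u + (-(c ^ 2 * v / 2)))) ∂(gaussianReal 0 v.toNNReal) :=
      fun x => integral_map (by fun_prop) (by fun_prop)
    simp_rw [inner]
    have pt : ∀ u u' : ℝ, min (Real.exp (c * u + (-(c ^ 2 * v / 2)))) (Real.exp (c * u' + (-(c ^ 2 * v / 2))))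
        = min (Real.exp (c * u)) (Real.exp (c * u')) * Real.exp (-(c ^ 2 * v / 2)) := fun u u' => by
      rw [Real.exp_add, Real.exp_add, min_mul_of_nonneg _ _ (Real.exp_pos _).le]
    simp_rw [pt, integral_mul_const]
    rw [Real.exp_neg, div_eq_mul_inv]
  rw [hEq] at hlim
  exact hlim


/-- **`= erfc(|c|σ/2)`** for `c ≠ 0`, `σ² ≠ 0` (the flow seat's `imh_lognormal_accRate_eq_erfc`). [ours] -/
theorem triangularPi_meanAccept_tendsto_erfc (hm : ∀ n, Measurable (h n)) {K : ℝ}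
    (hK : ∀ n y, |h n y| ≤ K) (h0 : ∀ n, ∫ y, h n y ∂ρ n = 0) {σ2 : ℝ}
    (hσ : Tendsto (fun n => Var[h n; ρ n]) atTop (𝓝 σ2)) {c : ℝ} (hc : c ≠ 0) (hσ2 : σ2 ≠ 0) :
    Tendsto (fun n : ℕ =>
        (∫ x, ∫ y, min (Real.exp (c / Real.sqrt n * ∑ i, h n (x i)))
              (Real.exp (c / Real.sqrt n * ∑ i, h n (y i)))
            ∂(Measure.pi fun _ : Fin n => ρ n) ∂(Measure.pi fun _ : Fin n => ρ n))
          / ∫ x, Real.exp (c / Real.sqrt n * ∑ i, h n (x i)) ∂(Measure.pi fun _ : Fin n => ρ n))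
      atTop (𝓝 (2 / Real.sqrt Real.pi
        * ∫ u in Ioi (Real.sqrt (c ^ 2 * σ2) / 2), Real.exp (-u ^ 2))) := by
  have hpos : 0 < c ^ 2 * σ2 :=
    mul_pos (by positivity) (lt_of_le_of_ne (variance_limit_nonneg hσ) (Ne.symm hσ2))
  have hs : (c ^ 2 * σ2).toNNReal ≠ 0 := fun h' =>
    absurd (Real.toNNReal_eq_zero.1 h') (not_le.2 hpos)
  have h' := triangularPi_meanAccept_tendsto hm hK h0 hσ c
  rw [Scoring.imh_lognormal_accRate_eq_erfc hs, Real.coe_toNNReal _ hpos.le] at h'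
  exact h'

/-- **ESS UNIVERSALITY**: along the same arrays the Kish ESS fraction `(M_n(β)²/M_n(2β))^n`,
`β = c/√n`, converges to the log-normal model's `e^{−s}`, `s = c²σ²`. [ours] -/
theorem triangularPi_essFrac_tendsto (hm : ∀ n, Measurable (h n)) {K : ℝ}
    (hK : ∀ n y, |h n y| ≤ K) (h0 : ∀ n, ∫ y, h n y ∂ρ n = 0) {σ2 : ℝ}
    (hσ : Tendsto (fun n => Var[h n; ρ n]) atTop (𝓝 σ2)) (c : ℝ) :
    Tendsto (fun n : ℕ => (mgf (h n) (ρ n) (c / Real.sqrt n) ^ 2 / mgf (h n) (ρ n) (2 * c / Real.sqrt n)) ^ n)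
      atTop (𝓝 (Real.exp (-(c ^ 2 * σ2)))) := by
  -- the arrays `a·h_n`: bounded by `|a|K`, centred, variance `→ a²σ²`
  have harr : ∀ a : ℝ, Tendsto (fun n : ℕ => mgf (h n) (ρ n) (a / Real.sqrt n) ^ n) atTop
      (𝓝 (Real.exp (a ^ 2 * σ2 / 2))) := by
    intro a
    have hm' : ∀ n, Measurable (fun y => a * h n y) := fun n => (hm n).const_mul a
    have hK' : ∀ n y, |a * h n y| ≤ |a| * K := fun n y => by
      rw [abs_mul]; exact mul_le_mul_of_nonneg_left (hK n y) (abs_nonneg a)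
    have h0' : ∀ n, ∫ y, a * h n y ∂ρ n = 0 := fun n => by rw [integral_const_mul, h0 n, mul_zero]
    have hσ' : Tendsto (fun n => Var[fun y => a * h n y; ρ n]) atTop (𝓝 (a ^ 2 * σ2)) := by
      have e : ∀ n, Var[fun y => a * h n y; ρ n] = a ^ 2 * Var[h n; ρ n] := fun n =>
        variance_const_mul a (h n) (ρ n)
      simp_rw [e]
      exact hσ.const_mul (a ^ 2)
    have h' := triangular_mgf_inv_sqrt_pow_tendsto hm' hK' h0' hσ'
    refine h'.congr fun n => ?_
    rw [mgf_const_mul, ← div_eq_mul_inv]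
  have h1 := harr c
  have h2 := harr (2 * c)
  have h3 := (h1.pow 2).div h2 (Real.exp_pos _).ne'
  have e : Real.exp (c ^ 2 * σ2 / 2) ^ 2 / Real.exp ((2 * c) ^ 2 * σ2 / 2) = Real.exp (-(c ^ 2 * σ2)) := by
    rw [← Real.exp_nat_mul, ← Real.exp_sub]; congr 1; ring
  rw [e] at h3
  refine h3.congr fun n => ?_
  simp only [Pi.div_apply]
  rw [div_pow, ← pow_mul, ← pow_mul, mul_comm n 2]

/-- **CEILING UNIVERSALITY**: the Bhattacharyya ceiling `(M_n(β/2)²/M_n(β))^n`, `β = c/√n`, of the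
acceptance converges to `e^{−s/4}`, `s = c²σ²`. [ours] -/
theorem triangularPi_bhattacharyyaCeiling_tendsto (hm : ∀ n, Measurable (h n)) {K : ℝ}
    (hK : ∀ n y, |h n y| ≤ K) (h0 : ∀ n, ∫ y, h n y ∂ρ n = 0) {σ2 : ℝ}
    (hσ : Tendsto (fun n => Var[h n; ρ n]) atTop (𝓝 σ2)) (c : ℝ) :
    Tendsto (fun n : ℕ => (mgf (h n) (ρ n) (c / 2 / Real.sqrt n) ^ 2 / mgf (h n) (ρ n) (c / Real.sqrt n)) ^ n)
      atTop (𝓝 (Real.exp (-(c ^ 2 * σ2 / 4)))) := by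
  have harr : ∀ a : ℝ, Tendsto (fun n : ℕ => mgf (h n) (ρ n) (a / Real.sqrt n) ^ n) atTop
      (𝓝 (Real.exp (a ^ 2 * σ2 / 2))) := by
    intro a
    have hm' : ∀ n, Measurable (fun y => a * h n y) := fun n => (hm n).const_mul a
    have hK' : ∀ n y, |a * h n y| ≤ |a| * K := fun n y => by
      rw [abs_mul]; exact mul_le_mul_of_nonneg_left (hK n y) (abs_nonneg a)
    have h0' : ∀ n, ∫ y, a * h n y ∂ρ n = 0 := fun n => by rw [integral_const_mul, h0 n, mul_zero]
    have hσ' : Tendsto (fun n => Var[fun y => a * h n y; ρ n]) atTop (𝓝 (a ^ 2 * σ2)) := by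
      have e : ∀ n, Var[fun y => a * h n y; ρ n] = a ^ 2 * Var[h n; ρ n] := fun n =>
        variance_const_mul a (h n) (ρ n)
      simp_rw [e]
      exact hσ.const_mul (a ^ 2)
    have h' := triangular_mgf_inv_sqrt_pow_tendsto hm' hK' h0' hσ'
    refine h'.congr fun n => ?_
    rw [mgf_const_mul, ← div_eq_mul_inv]
  have h1 := harr (c / 2)
  have h2 := harr c
  have h3 := (h1.pow 2).div h2 (Real.exp_pos _).ne'
  have e : Real.exp ((c / 2) ^ 2 * σ2 / 2) ^ 2 / Real.exp (c ^ 2 * σ2 / 2)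
      = Real.exp (-(c ^ 2 * σ2 / 4)) := by
    rw [← Real.exp_nat_mul, ← Real.exp_sub]; congr 1; ring
  rw [e] at h3
  refine h3.congr fun n => ?_
  simp only [Pi.div_apply]
  rw [div_pow, ← pow_mul, ← pow_mul, mul_comm n 2]

end Summit.Ventures.LatticeQCDFlow.Theory2

end
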